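import Mathlib
import HarnessLib
import Summits.HubbardSuperconductivity.HubbardSuperconductivity.Theorems.KLProgrammeKLRegimeWickScaleFlow

/-!
# Route `KLProgramme` — crux K3, ENGINE child gen 5 (stmt-HubbardSuperconductivity-19918 `KLRegimeEngineV14`), stub `stub_engine_step_values`,
# conjunct (E2-v9) at `1 ≤ n`: the scale flow of the Wick-smeared action is C¹ — `klws_continuousAt_wickSourceKernel_scale`

Cell gate-hubbard-kl, seat hubbard-kl-k3c1-p1 (g6), technique «composed-map remainder propagation».  Companion of
`…WickScaleFlow` (`klws_hasDerivAt_kernel_wickActionR`: `∂_Λ kernel_m(𝒲_Λ) = −½·kernel_m(e^{Δ_{D_Λ}}(δ𝒱_Λ/δψ, Ċ_Λ δ𝒱_Λ/δψ))`).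
The weighted Duhamel comparison `kltc_riccati_duhamel_weighted` (p500198) / `kltc_wickStep_of_flow` (p501252) needs the derivative `Γ̇`
CONTINUOUS along the slice (`hΓ'c`).  Here: the source `Λ ↦ kernel_m(e^{Δ_{D_Λ}}(δ𝒱_Λ/δψ, Ċ_Λ δ𝒱_Λ/δψ))` — with `Ċ_Λ` THE scale
derivative `deriv (hubbardCovAboveCT … · X Y) Λ` of the hard covariance — is itself DIFFERENTIABLE, hence continuous, at every `Λ ≠ 0` with
`Z^K_Λ ≠ 0`: Salmhofer's cutoff is smooth, so `Λ ↦ C^K_{>Λ}(X,Y)` is `C^∞` on `{Λ ≠ 0}` (`klws_contDiffOn_hardCov_scale`) and `Ċ_Λ` is again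
differentiable (`klws_hasDerivAt_derivHardCov_scale`); `𝒱_Λ` is coefficientwise differentiable (Polchinski, `hasCoeffDerivAt_effAction_flow`);
the source is built from these by the derivative pairing (`klws_hasCoeffDerivAt_grassmannDerivPairing`, trilinear) and the smearing
(`HasCoeffDerivAt.gaussConv`), so the landed coefficientwise calculus differentiates it once more (`klws_exists_hasCoeffDerivAt_wickSource`).

* §1 generic: `klws_hasCoeffDerivAt_grassmannDerivPairing`, `klws_exists_hasCoeffDerivAt_wickSource`, `klws_continuousAt_kernel_wickSource`.
* §2 model (seed `h = 0`, frame `K`): `klws_contDiffOn_cutoffWeight_scale`, `klws_contDiffOn_hardCov_scale`, `klws_hasDerivAt_derivHardCov_scale`,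
  `klws_continuousAt_derivHardCov_scale`, **`klws_continuousAt_wickSourceKernel_scale`** (kernels), `klws_continuousAt_wickSourceVertexFn_scale`,
  **`klws_continuousAt_pairKernelR_deriv_scale`** (the pair-kernel derivative of `klws_hasDerivAt_pairKernelR`, verbatim), and the `ContinuousOn`
  form on any set of admissible scales `klws_continuousOn_pairKernelR_deriv_scale`.

Exact calculus over landed lemmas; no analytic bound and nothing about superconductivity is asserted.  0 kit.
-/

noncomputable section

namespace Summit.HubbardSuperconductivity.HubbardSuperconductivity.Theorems.KLRegimeWick

set_option linter.dupNamespace false -- summit = problem name (single-conjunct summit), D-0017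

open Finset Literature.MathematicalPhysics.QuantumLattice GrassmannAlgebra
open scoped Topology

/-! ## §1 Generic: the source of the Wick flow is differentiable once more -/

section Generic

variable {𝕂 : Type*} [NontriviallyNormedField 𝕂] {𝕜 : Type*} [RCLike 𝕜] [NormedAlgebra 𝕂 𝕜]
variable {Γ : Type*} [LinearOrder Γ] [Fintype Γ]

/-- **The derivative pairing along differentiable curves** (trilinear rule):
`(δa_r/δψ, B_r δb_r/δψ)' = (δa/δψ, Ḃ δb/δψ) + (δa'/δψ, B δb/δψ) + (δa/δψ, B δb'/δψ)`. -/
theorem klws_hasCoeffDerivAt_grassmannDerivPairing {B : 𝕂 → Matrix Γ Γ 𝕜} {B' : Matrix Γ Γ 𝕜} {t : 𝕂}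
    (hB : ∀ X Y, HasDerivAt (fun r => B r X Y) (B' X Y) t) {a b : 𝕂 → GrassmannAlgebra 𝕜 Γ} {a' b' : GrassmannAlgebra 𝕜 Γ}
    (ha : HasCoeffDerivAt a a' t) (hb : HasCoeffDerivAt b b' t) :
    HasCoeffDerivAt (fun r => grassmannDerivPairing 𝕜 (B r) (a r) (b r))
      (grassmannDerivPairing 𝕜 B' (a t) (b t) + grassmannDerivPairing 𝕜 (B t) a' (b t) +
        grassmannDerivPairing 𝕜 (B t) (a t) b') t := by
  simp only [grassmannDerivPairing_apply]
  rw [← Finset.sum_add_distrib, ← Finset.sum_add_distrib]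
  simp_rw [← Finset.sum_add_distrib]
  refine HasCoeffDerivAt.sum Finset.univ fun X _ => HasCoeffDerivAt.sum Finset.univ fun Y _ => ?_
  have h := HasCoeffDerivAt.smul (hB X Y) ((ha.linearMap (grassmannDeriv 𝕜 X)).mul (hb.linearMap (grassmannDeriv 𝕜 Y)))
  refine h.congr_deriv ?_
  rw [smul_add, add_assoc]

/-- **The smeared source `e^{Δ_{D_r}}(δ𝒱_r/δψ, B_r δ𝒱_r/δψ)` is coefficientwise differentiable** along any differentiable covariance
curve `C_r` (`D_r = C∞ − C_r`, `𝒱_r = effAction (C r) V`, `Z_t ≠ 0`) and any differentiable rung matrix `B_r`. -/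
theorem klws_exists_hasCoeffDerivAt_wickSource {C : 𝕂 → Matrix Γ Γ 𝕜} {C' : Matrix Γ Γ 𝕜} {t : 𝕂}
    (Cinf : Matrix Γ Γ 𝕜) (hC : ∀ X Y, HasDerivAt (fun r => C r X Y) (C' X Y) t) {V : GrassmannAlgebra 𝕜 Γ}
    (hV0 : constPart 𝕜 V = 0) (hVe : V ∈ evenOdd 𝕜 0) (hZt : effPartitionFn 𝕜 (C t) V ≠ 0)
    {B : 𝕂 → Matrix Γ Γ 𝕜} {B' : Matrix Γ Γ 𝕜} (hB : ∀ X Y, HasDerivAt (fun r => B r X Y) (B' X Y) t) :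
    ∃ S' : GrassmannAlgebra 𝕜 Γ, HasCoeffDerivAt (fun r => gaussConv 𝕜 (Cinf - C r)
      (grassmannDerivPairing 𝕜 (B r) (effAction 𝕜 (C r) V) (effAction 𝕜 (C r) V))) S' t := by
  have hW := (hasCoeffDerivAt_effAction_flow hC hV0 hVe hZt).1
  exact ⟨_, (klws_hasCoeffDerivAt_grassmannDerivPairing hB hW hW).gaussConv (hasDerivAt_sub_cov Cinf hC)⟩

/-- **The kernels of the smeared source are continuous** at such a point (differentiable ⇒ continuous). -/
theorem klws_continuousAt_kernel_wickSource {C : 𝕂 → Matrix Γ Γ 𝕜} {C' : Matrix Γ Γ 𝕜} {t : 𝕂}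
    (Cinf : Matrix Γ Γ 𝕜) (hC : ∀ X Y, HasDerivAt (fun r => C r X Y) (C' X Y) t) {V : GrassmannAlgebra 𝕜 Γ}
    (hV0 : constPart 𝕜 V = 0) (hVe : V ∈ evenOdd 𝕜 0) (hZt : effPartitionFn 𝕜 (C t) V ≠ 0)
    {B : 𝕂 → Matrix Γ Γ 𝕜} {B' : Matrix Γ Γ 𝕜} (hB : ∀ X Y, HasDerivAt (fun r => B r X Y) (B' X Y) t)
    (m : ℕ) (X : Fin m → Γ) :
    ContinuousAt (fun r => kernel 𝕜 (gaussConv 𝕜 (Cinf - C r)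
      (grassmannDerivPairing 𝕜 (B r) (effAction 𝕜 (C r) V) (effAction 𝕜 (C r) V))) m X) t := by
  obtain ⟨S', h⟩ := klws_exists_hasCoeffDerivAt_wickSource Cinf hC hV0 hVe hZt hB
  have h' := h.apply (kernelLM 𝕜 Γ m X)
  simp only [kernelLM_apply] at h'
  exact h'.continuousAt

end Generic

/-! ## §2 The model: smooth cutoff ⇒ the scale derivative of the hard covariance is differentiable; continuity of the source -/

section Model

open Literature.Probability.LatticeModels
open Summit.HubbardSuperconductivity.HubbardSuperconductivity.Theorems.KLProgrammeLegKernels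
open Summit.HubbardSuperconductivity.HubbardSuperconductivity.Theorems.KLRegimeSplit

variable (L M : ℕ) [NeZero L] (β U μ : ℝ) (K : TrigPolyC4v)

omit [NeZero L] in
/-- **The cutoff weight is smooth in the scale away from `Λ = 0`**: `Λ ↦ χ₂((ω² + e_K²)/Λ²)`. -/
theorem klws_contDiffOn_cutoffWeight_scale {n : ℕ∞} (k : FreqMomentum L M) :
    ContDiffOn ℝ n (fun Λ : ℝ => hubbardCutoffWeightCT L M β μ K Λ k) {Λ : ℝ | Λ ≠ 0} := by
  unfold hubbardCutoffWeightCT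
  refine (contDiff_salmhoferCutoff (n := n)).comp_contDiffOn ?_
  exact contDiffOn_const.div (contDiffOn_id.pow 2) fun Λ hΛ => pow_ne_zero 2 hΛ

omit [NeZero L] in
/-- **The hard covariance is smooth in the scale away from `Λ = 0`**, entrywise. -/
theorem klws_contDiffOn_hardCov_scale {n : ℕ∞} (X Y : HubbardFieldIdx L M) :
    ContDiffOn ℝ n (fun Λ : ℝ => hubbardCovAboveCT L M β μ 0 K Λ X Y) {Λ : ℝ | Λ ≠ 0} := by
  have hw : ContDiffOn ℝ n (fun Λ : ℝ => (((hubbardCutoffWeightCT L M β μ K Λ (momentumOf L M X) +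
      hubbardCutoffWeightCT L M β μ K Λ (momentumOf L M Y)) / 2 : ℝ) : ℂ)) {Λ : ℝ | Λ ≠ 0} :=
    Complex.ofRealCLM.contDiff.comp_contDiffOn
      (((klws_contDiffOn_cutoffWeight_scale L M β μ K _).add (klws_contDiffOn_cutoffWeight_scale L M β μ K _)).div_const 2)
  simpa only [hubbardCovAboveCT, Matrix.of_apply] using hw.mul contDiffOn_const

omit [NeZero L] in
/-- **The scale derivative `Ċ_Λ(X,Y)` of the hard covariance is again differentiable** at `Λ ≠ 0`. -/
theorem klws_hasDerivAt_derivHardCov_scale {Λ : ℝ} (hΛ : Λ ≠ 0) (X Y : HubbardFieldIdx L M) :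
    HasDerivAt (fun Λ' : ℝ => deriv (fun Λ'' : ℝ => hubbardCovAboveCT L M β μ 0 K Λ'' X Y) Λ')
      (deriv (deriv (fun Λ'' : ℝ => hubbardCovAboveCT L M β μ 0 K Λ'' X Y)) Λ) Λ := by
  have h2 : ContDiffOn ℝ 2 (fun Λ'' : ℝ => hubbardCovAboveCT L M β μ 0 K Λ'' X Y) {Λ : ℝ | Λ ≠ 0} :=
    klws_contDiffOn_hardCov_scale L M β μ K X Y
  have h1 : ContDiffOn ℝ 1 (deriv fun Λ'' : ℝ => hubbardCovAboveCT L M β μ 0 K Λ'' X Y) {Λ : ℝ | Λ ≠ 0} :=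
    h2.deriv_of_isOpen isOpen_ne (by norm_num)
  exact ((h1.differentiableOn one_ne_zero).differentiableAt (isOpen_ne.mem_nhds hΛ)).hasDerivAt

omit [NeZero L] in
/-- … hence continuous there. -/
theorem klws_continuousAt_derivHardCov_scale {Λ : ℝ} (hΛ : Λ ≠ 0) (X Y : HubbardFieldIdx L M) :
    ContinuousAt (fun Λ' : ℝ => deriv (fun Λ'' : ℝ => hubbardCovAboveCT L M β μ 0 K Λ'' X Y) Λ') Λ :=
  (klws_hasDerivAt_derivHardCov_scale L M β μ K hΛ X Y).continuousAt

/-- **The source of the Wick scale flow has continuous kernels**: at every `Λ ≠ 0` with `Z^K_Λ ≠ 0`,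
`Λ' ↦ kernel_m(e^{Δ_{D_{Λ'}}}(δ𝒱_{Λ'}/δψ, Ċ_{Λ'} δ𝒱_{Λ'}/δψ))` is continuous at `Λ`, `Ċ_{Λ'}(X,Y) = deriv (C^K_{>·}(X,Y)) Λ'`. -/
theorem klws_continuousAt_wickSourceKernel_scale {Λ : ℝ} (hΛ : Λ ≠ 0) (hZ : hubbardEffPartitionFnCT L M β U μ 0 K Λ ≠ 0)
    (m : ℕ) (X : Fin m → HubbardFieldIdx L M) :
    ContinuousAt (fun Λ' : ℝ => kernel ℂ (gaussConv ℂ (hubbardCovBelowCT L M β μ 0 K Λ')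
      (grassmannDerivPairing ℂ
        (Matrix.of fun X Y : HubbardFieldIdx L M => deriv (fun Λ'' : ℝ => hubbardCovAboveCT L M β μ 0 K Λ'' X Y) Λ')
        (hubbardEffectiveActionCT L M β U μ 0 K Λ') (hubbardEffectiveActionCT L M β U μ 0 K Λ'))) m X) Λ := by
  letI : LinearOrder (HubbardFieldIdx L M) := LinearOrder.lift' (Fintype.equivFin _) (Fintype.equivFin _).injective
  exact klws_continuousAt_kernel_wickSource (𝕂 := ℝ) (hubbardCovarianceCT L M β μ 0 K)
    (klws_hasDerivAt_hardCov_scale L M β μ K hΛ) (constPart_hubbardInteractionCT L M β U K)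
    (AposterioriCapRgSeededBrokenRegimeBoseFermiPinned.hubbardInteractionCT_mem_evenOdd_zero L M β U K) hZ
    (B := fun Λ' => Matrix.of fun X Y : HubbardFieldIdx L M => deriv (fun Λ'' : ℝ => hubbardCovAboveCT L M β μ 0 K Λ'' X Y) Λ')
    (B' := Matrix.of fun X Y : HubbardFieldIdx L M => deriv (deriv (fun Λ'' : ℝ => hubbardCovAboveCT L M β μ 0 K Λ'' X Y)) Λ)
    (fun X Y => klws_hasDerivAt_derivHardCov_scale L M β μ K hΛ X Y) m X

/-- … and continuous vertex functions. -/
theorem klws_continuousAt_wickSourceVertexFn_scale {Λ : ℝ} (hΛ : Λ ≠ 0) (hZ : hubbardEffPartitionFnCT L M β U μ 0 K Λ ≠ 0)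
    (m : ℕ) (X : Fin m → HubbardFieldIdx L M) :
    ContinuousAt (fun Λ' : ℝ => vertexFn L M β (gaussConv ℂ (hubbardCovBelowCT L M β μ 0 K Λ')
      (grassmannDerivPairing ℂ
        (Matrix.of fun X Y : HubbardFieldIdx L M => deriv (fun Λ'' : ℝ => hubbardCovAboveCT L M β μ 0 K Λ'' X Y) Λ')
        (hubbardEffectiveActionCT L M β U μ 0 K Λ') (hubbardEffectiveActionCT L M β U μ 0 K Λ'))) m X) Λ := by
  simp only [vertexFn_def]
  exact continuousAt_const.mul (klws_continuousAt_wickSourceKernel_scale L M β U μ K hΛ hZ m X)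

/-- **The scale derivative of the real-cutoff Wick pair kernel is continuous** — the function of `klws_hasDerivAt_pairKernelR` (with
`Ċ_Λ = deriv C^K_{>·}`), verbatim: the `hΓ'c` input of `kltc_riccati_duhamel_weighted` / `kltc_wickStep_of_flow` before reparametrisation. -/
theorem klws_continuousAt_pairKernelR_deriv_scale {Λ : ℝ} (hΛ : Λ ≠ 0) (hZ : hubbardEffPartitionFnCT L M β U μ 0 K Λ ≠ 0)
    (Q : TorusSite 2 L) (x y : TorusSite 2 L × MatsubaraIdx M) :
    ContinuousAt (fun Λ' : ℝ => -((2 : ℂ)⁻¹ * vertexFn L M β (gaussConv ℂ (hubbardCovBelowCT L M β μ 0 K Λ')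
      (grassmannDerivPairing ℂ
        (Matrix.of fun X Y : HubbardFieldIdx L M => deriv (fun Λ'' : ℝ => hubbardCovAboveCT L M β μ 0 K Λ'' X Y) Λ')
        (hubbardEffectiveActionCT L M β U μ 0 K Λ') (hubbardEffectiveActionCT L M β U μ 0 K Λ'))) 4
      ![(((y.2, y.1), 0), 0), (((y.2.rev, Q - y.1), 1), 0), (((x.2.rev, Q - x.1), 1), 1), (((x.2, x.1), 0), 1)])) Λ :=
  (continuousAt_const.mul (klws_continuousAt_wickSourceVertexFn_scale L M β U μ K hΛ hZ 4 _)).neg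

/-- **`ContinuousOn` form**: on any set of scales avoiding `0` on which the partition function does not vanish (e.g. a slice
`[Λ_n, Λ_{n−1}]` in the regime), the scale derivative of the real-cutoff pair kernel is continuous. -/
theorem klws_continuousOn_pairKernelR_deriv_scale {S : Set ℝ} (hS0 : ∀ Λ ∈ S, Λ ≠ 0)
    (hSZ : ∀ Λ ∈ S, hubbardEffPartitionFnCT L M β U μ 0 K Λ ≠ 0) (Q : TorusSite 2 L) (x y : TorusSite 2 L × MatsubaraIdx M) :
    ContinuousOn (fun Λ' : ℝ => -((2 : ℂ)⁻¹ * vertexFn L M β (gaussConv ℂ (hubbardCovBelowCT L M β μ 0 K Λ')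
      (grassmannDerivPairing ℂ
        (Matrix.of fun X Y : HubbardFieldIdx L M => deriv (fun Λ'' : ℝ => hubbardCovAboveCT L M β μ 0 K Λ'' X Y) Λ')
        (hubbardEffectiveActionCT L M β U μ 0 K Λ') (hubbardEffectiveActionCT L M β U μ 0 K Λ'))) 4
      ![(((y.2, y.1), 0), 0), (((y.2.rev, Q - y.1), 1), 0), (((x.2.rev, Q - x.1), 1), 1), (((x.2, x.1), 0), 1)])) S :=
  fun Λ hΛ => (klws_continuousAt_pairKernelR_deriv_scale L M β U μ K (hS0 Λ hΛ) (hSZ Λ hΛ) Q x y).continuousWithinAt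

end Model

end Summit.HubbardSuperconductivity.HubbardSuperconductivity.Theorems.KLRegimeWick

end
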